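/-
Copyright (c) 2026 the pub-hodgecm-mathlib formalisation cell (harness21).  Prover seat hodgecm-mathlib-K2E3-p29 (g4), Track B ∕ R90-TF, h413 = `stmt-HodgeConjecture-24833`,
R90-TF section S8 «ContSpec-n½» (S8 dealer R90-CS-plan (g4) S8-R255): the per-generator AXIS LETTERS of (R)′τ — K2E2-p12 (g10)'s V2 binders `hreal` (axis reality of the Maass–Selberg cross
scalar near `3∕2`) and `hPreal` (off-axis pole exclusion of the continued scattering coordinates in `{1 < Re}`) FOR AN ARBITRARY `K_∞`-finite τ-admissible generator.  `hreal` is PAID,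
generator-free, by J-S8-RE road (3) at the exports level (★ p864973 §2) fed by the exports-with-(E6) τ-row (★ p865131, this seat) and the (L2) scalars read off ANY column data (★
`exists_scalars_of_coords_global`).  `hPreal` is reduced to its analytic heart [MoeglinWaldspurger1995, IV.1.11]: OFF-AXIS BOUNDEDNESS of the coordinates near every off-axis point — PLUS the
exports' normal-form clause, without which the V2 letter is not dischargeable for ∀-bound data (a junk value at one off-axis candidate satisfies every other clause).
-/
import Summits.HodgeConjecture.HodgeConjecture.Theorems.R90S8ResGMidTauExportsRowOfPortsU3        -- ★ p865131 FILE 2 (this seat): `hTEXP6_row_of_ports`; brings ★ p865084, ★ p864638, the frames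
import Summits.HodgeConjecture.HodgeConjecture.Theorems.R90S8ResGMidBlockLeResidualOfRecordV2U3   -- ★ p865056 (K2E2-p12): V2 — the consumer's binder bytes; brings ★ p864973 `im_wc_eq_zero_of_exports_free`, ★ `exists_scalars_of_coords_global`, ★ `eventually_im_eq_zero_of_real_offPoles`, ★ `integrable_restrict_mul_conj_of_bounded`
import Summits.HodgeConjecture.HodgeConjecture.Theorems.K2E1ChiAxisRealityOfRecordCMThree           -- ★ p864973 (K2E1-p15): J-S8-RE road (3) `im_wc_eq_zero_of_exports_free`; brings ★ `exists_scalars_of_coords_global`, ★ `eventually_im_eq_zero_of_real_offPoles`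
import Summits.HodgeConjecture.HodgeConjecture.Theorems.R90S8ResGMidBlockMSRoadOfLettersU3        -- ★ `midBlockChar_posRealIdele` (the block character is trivial on the positive real ideles under `hquad`)
import Summits.HodgeConjecture.HodgeConjecture.Theorems.K2E1BLRemovablePolesU                     -- ★ `MeromorphicNFAt.analyticAt_of_eventually_norm_le` (Riemann in normal form)
import HarnessLib

/-!
# S8 (R)′ road — `R90S8ResGMidTauAxisLettersOfPortsU3`: THE PER-GENERATOR AXIS LETTERS OF (R)′τ — `hreal` PAID GENERATOR-FREE; `hPreal` REDUCED TO OFF-AXIS BOUNDEDNESS [MW95 IV.1.11]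

Track B ∕ R90-TF, crux h413 = `stmt-HodgeConjecture-24833`, route of record `HCCMUnconditional`; cell `hodgecm-mathlib`, R90-TF section S8 «ContSpec-n½ ∕ ResidualSpectrum», sub-socket (R)′
(B ED. 7 :337) via K2E2-p12 (g10)'s (R)′τ OF RECORD ★ p865056 `resGMidBlockτ_le_residual_of_record_v2` — per-τ-generator binders `hreal` (:234–:250) and `hPreal` (:217–:232).  THEOREMS ONLY (no
`def`, no `instance`, no `notation`, no named-fact hypothesis, no `sorry`; default heartbeats); lane `--supports stmt-HodgeConjecture-24833 --as helper` (count-neutral).  CLOSES NO SOCKET.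

THE MATHEMATICS ([MoeglinWaldspurger1995, IV.1.10–IV.1.11, IV.2.3, IV.3.12 (a)]; [Langlands1976, §7]; [BernsteinLapid2019, Thm 2.3, §4]).
`hreal` (§2).  J-S8-RE road (3) — ★ p864973 §2 `im_wc_eq_zero_of_exports_free` — is stated AT THE EXPORTS LEVEL for a GENERIC pair `(χ₁, χ₂)` (`χ₁` unitary and trivial on the positive real
ideles, `|χ₂| = 1`, `χ₂` automorphic) and ANY continuous bounded pair-section `φ`: from the exports (`Ec` + tube identity, closed co-discrete `P`, the (E6) family `Fam` at a level `T ≥ 1`),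
the (L2) continued scalars `wc`, `Bc` holomorphic off `P` with their tube agreements, and a real `x > 1` off `P` with `Bc z z` bounded near `x`, the continued diagonal identity
`‖Fam z‖² = four-term(z)` on the two quarter-plane domains and positivity give `Im wc(x) = 0` — no adjoint relation, no self-associate split.  For an ARBITRARY `K_∞`-finite τ-admissible
generator `(U₀, φ)` with package `(ν, 𝓕)` every input is now ★ or V2's ∀-bound data: (E6) at `T = 1` is the exports-with-(E6) τ-row (★ p865131 `hTEXP6_row_of_ports`, here hypothesis-first as
`hTEXP6` in §2.1 and discharged in §2.2); the (L2) scalars are ★ `exists_scalars_of_coords_global` on V2's column data `(ι, φ', qv, qcv, Pv)` — it needs `IsClosed Pv`, which CO-DISCRETENESS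
implies (§1: a set that every point avoids on a punctured neighbourhood has open complement), `DifferentiableOn (qcv j) Pvᶜ` (V2's «analytic off `Pv`»), and the integrability of
`φ'ⱼ·conj φ`, `φ'ⱼ·conj φ'ₗ` on `K_max` (★ `integrable_restrict_mul_conj_of_bounded`; `φ` is bounded by ★ `exists_norm_le_of_isChiSectionPair`); its clause `hwcf` IS V2's closed formula
for `wc`; `Bc z z` is bounded near any point where all `qcv j` are analytic (★ `exists_eventually_norm_kernelDiag_le_of_coords`); the road runs with the pole set `P₆ ∪ Pv` (closed,
co-discrete); the block character `ξ.bcη⁻¹·ξ.bcψ⁻¹·μω` is unitary (★ `isUnitary_blockChar`) and trivial on the positive real ideles (★ `midBlockChar_posRealIdele`, from the socket's `hquad`);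
and pointwise reality off `P₆ ∪ Pv` becomes V2's «`∀ᶠ x in 𝓝[≠] (3∕2 : ℝ)`» by ★ `eventually_im_eq_zero_of_real_offPoles`.
`hPreal` (§3).  [MW95 IV.1.11]: the continued coordinates have no singularity off the real axis in `{1 < Re}`.  Its analytic heart is OFF-AXIS BOUNDEDNESS — `‖Fam z‖² ≥ 0` in the diagonal
identity, whose `Bc z z`-term is a positive-definite Gram form in `qcv(z)` with a NEGATIVE coefficient for `Re z > 1`, forces `|qcv(z)|` bounded near every off-axis point (letter `hOFFBD`,
NOT proved here); boundedness plus the exports' NORMAL-FORM clause gives analyticity (Riemann, ★ `MeromorphicNFAt.analyticAt_of_eventually_norm_le`).  HONEST FLAG: V2's `hPreal`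
(:217–:232) quantifies over column data WITHOUT the normal-form clause and is therefore not dischargeable as typed (a tuple with one junk value at an off-axis point of `Pv ∩ {1 < Re < 2}`
satisfies every listed clause and violates the conclusion); §3 states the row WITH the clause `∀ j, MeromorphicNFOn (qcv j) univ` appended to the data (the exports print it: (E1) of ★
p864592 ∕ ★ p864481), for V3 to adopt.
* §1 `isClosed_of_codiscrete` (topology), `differentiableOn_compl_of_analyticAt_off`.
* §2 **`hreal_row_of_truncatedExportsRow (hμu) (hquad) (hTEXP6)`** and **`hreal_row_of_ports (hμu) (hquad) (hCO′)`** ⊢ V2's `hreal` binder (:234–:250) BYTE FOR BYTE — visible: (F) `μ νG β hβ μZ hμZ` +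
  Borel structures on `G(𝔸)`, `G_∞`, `G(𝔸_f)`, `𝔸_L^×`; (U) `hμu`; (Q) `hquad` (the socket's own `hμω`); and (E6) as `hTEXP6` resp. (F′) `μa μf` + (L′) `hCO′`.
* §3 `analyticAt_offAxis_of_bound` (generic: NF + bounded near `z₀` ⇒ analytic at `z₀`), **`hPreal_row_of_offAxisBound (hOFFBD)`** ⊢ V2's `hPreal` conclusion for the data WITH the normal-form
  clause — `hPreal` = ★ modulo the honest [MW95 IV.1.11] letter `hOFFBD` (off-axis boundedness of the coordinates), stated in the same per-generator currency.
HONEST LABEL: HC_CM is proved only modulo the 7 printed citations (2 remaining named inputs: hLiu418 = `stmt-HodgeConjecture-24832`, h413 = `stmt-HodgeConjecture-24833`) until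
rung 0 closes; `hreal` goes L → ★ modulo (F)(U)(Q)+(E6); `hPreal` stays L as `hOFFBD` (+ the NF clause flag to V3); (R)′ :337 stays `sorry` in B ED. 7; pays no socket; count-neutral.

## References
* [MoeglinWaldspurger1995] C. Mœglin, J.-L. Waldspurger, *Spectral Decomposition and Eisenstein Series* (1995), IV.1.10–IV.1.11, IV.2.3, IV.3.12 (a).
* [Langlands1976] R. P. Langlands, *On the Functional Equations Satisfied by Eisenstein Series*, LNM 544 (1976), §7.
* [BernsteinLapid2019] J. Bernstein, E. Lapid, *On the meromorphic continuation of Eisenstein series*, J. Amer. Math. Soc. 37 (2024), Thm 2.3, §4.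
* [Rogawski1990] J. D. Rogawski, *Automorphic Representations of Unitary Groups in Three Variables* (1990), §12.1 p. 171, §13.9 p. 229 (ii).
* [Conway1978] J. B. Conway, *Functions of One Complex Variable I*, 2nd ed. (1978), V §1 (removable singularities).
-/

set_option autoImplicit false
set_option linter.dupNamespace false  -- the mandated namespace `…HodgeConjecture.HodgeConjecture.R90.S8` (LEAD #1 L1) repeats the summit's segment

noncomputable section

open MeasureTheory Measure NumberField IsDedekindDomain Set Filter Topology ContRepresentation Complex
open scoped ENNReal NNReal ComplexConjugate InnerProductSpace Topology
open Literature.NumberTheory Literature.NumberTheory.Automorphic Literature.NumberTheory.Automorphic.UnitaryGroup Literature.NumberTheory.GaloisRepresentations AdelicGroupData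
open Literature.NumberTheory.Automorphic.Arthur2013.Leaves.TECR Literature.NumberTheory.Rogawski1990 Literature.NumberTheory.LFunctions Literature.MeasureTheory.Group
open Summit.HodgeConjecture.HodgeConjecture.Cruxes.H413.K2E1BorelEisensteinU Summit.HodgeConjecture.HodgeConjecture.Cruxes.H413.K2E1CharacterEisensteinU2Defs
open Summit.HodgeConjecture.HodgeConjecture.Cruxes.H413.K2E1CharacterEisensteinU3PairDefs Summit.HodgeConjecture.HodgeConjecture.Cruxes.H413.K2E1ChiSectionSpaceU3PairDefs
open Summit.HodgeConjecture.HodgeConjecture.Cruxes.H413.K2E1BLBorelSpacesU2Defs Summit.HodgeConjecture.HodgeConjecture.Cruxes.H413.K2E1BLBorelOperatorsU2Defs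
open Summit.HodgeConjecture.HodgeConjecture.Cruxes.H413.R90S8ResGMidBlockScatteringOfRecordU3 (integrable_restrict_mul_conj_of_bounded)
open Summit.HodgeConjecture.HodgeConjecture.Cruxes.H413.K2E1ChiAxisRealityOfRecordCMThree (im_wc_eq_zero_of_exports_free)
open Summit.HodgeConjecture.HodgeConjecture.Cruxes.H413.K2E1ChiMaassSelbergOnAxisScalarsOfRecordCMThree (exists_scalars_of_coords_global exists_eventually_norm_kernelDiag_le_of_coords eventually_im_eq_zero_of_real_offPoles)

namespace Summit.HodgeConjecture.HodgeConjecture.R90.S8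

/-! ## §1 Two pieces of plumbing: co-discrete sets are closed; «analytic off `P`» is «holomorphic on `Pᶜ`» -/

/-- **A CO-DISCRETE SET IS CLOSED**: if every point has a punctured neighbourhood missing `P` (`∀ z₀, ∀ᶠ s in 𝓝[≠] z₀, s ∉ P` — the exports' pole-set clause), then `Pᶜ` is open.
[cite: Conway1978, V §1] -/
theorem isClosed_of_codiscrete {P : Set ℂ} (hPcd : ∀ z₀ : ℂ, ∀ᶠ s in 𝓝[≠] z₀, s ∉ P) : IsClosed P := by
  rw [← isOpen_compl_iff, isOpen_iff_mem_nhds]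
  intro z₀ hz₀
  filter_upwards [eventually_nhdsWithin_iff.1 (hPcd z₀)] with s hs
  by_cases hsz : s = z₀
  · rw [hsz]; exact hz₀
  · exact hs hsz

/-- «`qc` analytic at every point off `P`» gives «`qc` holomorphic on `Pᶜ`». [cite: Conway1978, V §1] -/
theorem differentiableOn_compl_of_analyticAt_off {qc : ℂ → ℂ} {P : Set ℂ} (h : ∀ z : ℂ, z ∉ P → AnalyticAt ℂ qc z) : DifferentiableOn ℂ qc Pᶜ :=
  fun z hz => (h z hz).differentiableAt.differentiableWithinAt

/-! ## §2 `hreal` for an arbitrary `K_∞`-finite τ-admissible generator -/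

section Row

variable (L : Type) [Field L] [NumberField L] [IsCMField L]
  [MeasurableSpace (quasiSplit (↥(maximalRealSubfield L)) L (IsCMField.complexConj L) 3).Adelic] [BorelSpace (quasiSplit (↥(maximalRealSubfield L)) L (IsCMField.complexConj L) 3).Adelic]
  [MeasurableSpace ↥(arch (↥(maximalRealSubfield L)) L (IsCMField.complexConj L) 3 ((StdForm.antidiagonal 3).over L))] [BorelSpace ↥(arch (↥(maximalRealSubfield L)) L (IsCMField.complexConj L) 3 ((StdForm.antidiagonal 3).over L))] [MeasurableSpace ↥(finAdelic (↥(maximalRealSubfield L)) L (IsCMField.complexConj L) 3 ((StdForm.antidiagonal 3).over L))] [BorelSpace ↥(finAdelic (↥(maximalRealSubfield L)) L (IsCMField.complexConj L) 3 ((StdForm.antidiagonal 3).over L))]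
  [MeasurableSpace (AdeleRing (𝓞 L) L)ˣ] [BorelSpace (AdeleRing (𝓞 L) L)ˣ]
  (μ : Measure (quasiSplit (↥(maximalRealSubfield L)) L (IsCMField.complexConj L) 3).automorphicQuotient) [(quasiSplit (↥(maximalRealSubfield L)) L (IsCMField.complexConj L) 3).IsAutomorphicMeasure μ]
  (νG : Measure (quasiSplit (↥(maximalRealSubfield L)) L (IsCMField.complexConj L) 3).Adelic) [νG.IsHaarMeasure] [νG.IsInvInvariant] [SFinite νG]
  {β : (quasiSplit (↥(maximalRealSubfield L)) L (IsCMField.complexConj L) 3).Adelic → ℝ≥0∞}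
  (hβ : IsCoveringWeight ↥((arithmeticBorel (↥(maximalRealSubfield L)) L (IsCMField.complexConj L) 3).map (quasiSplit (↥(maximalRealSubfield L)) L (IsCMField.complexConj L) 3).arithmeticSubgroup.subtype) β)
  {μZ : Measure (borelQuotient (↥(maximalRealSubfield L)) L (IsCMField.complexConj L) 3)} [SFinite μZ]
  (hμZ : ∀ f : borelQuotient (↥(maximalRealSubfield L)) L (IsCMField.complexConj L) 3 → ℝ≥0∞, Measurable f → ∫⁻ z, f z ∂μZ = ∫⁻ g, β g * f (toBorelQuotient (↥(maximalRealSubfield L)) L (IsCMField.complexConj L) 3 g) ∂νG)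
  (μa : Measure ↥(arch (↥(maximalRealSubfield L)) L (IsCMField.complexConj L) 3 ((StdForm.antidiagonal 3).over L))) [μa.IsHaarMeasure] [μa.IsMulRightInvariant]
  (μf : Measure ↥(finAdelic (↥(maximalRealSubfield L)) L (IsCMField.complexConj L) 3 ((StdForm.antidiagonal 3).over L))) [μf.IsHaarMeasure]
  (ξ : OneDimAutRepH L) (μω : HeckeCharacter L)

omit [MeasurableSpace ↥(arch (↥(maximalRealSubfield L)) L (IsCMField.complexConj L) 3 ((StdForm.antidiagonal 3).over L))] [BorelSpace ↥(arch (↥(maximalRealSubfield L)) L (IsCMField.complexConj L) 3 ((StdForm.antidiagonal 3).over L))]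
  [MeasurableSpace ↥(finAdelic (↥(maximalRealSubfield L)) L (IsCMField.complexConj L) 3 ((StdForm.antidiagonal 3).over L))] [BorelSpace ↥(finAdelic (↥(maximalRealSubfield L)) L (IsCMField.complexConj L) 3 ((StdForm.antidiagonal 3).over L))] [SFinite νG] in
include νG hβ in
/-- **§2.1 — `hreal_row_of_truncatedExportsRow`**: V2's per-generator AXIS-REALITY letter `hreal` (★ p865056 :234–:250, BYTE FOR BYTE) from `hμu`, the socket's quadratic letter `hquad` and the
exports-with-(E6) τ-row `hTEXP6` (hypothesis-first; ★ p865131 pays it): for every `K_∞`-finite τ-admissible generator `(U₀, φ)`, every normalised Heisenberg package, every column datum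
`(ι, φ', qv, qcv, Pv)` with V2's clauses and every Maass–Selberg frame `(μK, νI, 𝓕I)`, the closed-formula cross scalar `wc` is REAL on the punctured real neighbourhood of `3∕2` — J-S8-RE
road (3) ★ `im_wc_eq_zero_of_exports_free` with the pole set `P₆ ∪ Pv`, (E6) at `T = 1`, (L2) ★ `exists_scalars_of_coords_global`, `hβB` ★ `exists_eventually_norm_kernelDiag_le_of_coords`,
then ★ `eventually_im_eq_zero_of_real_offPoles` at `x₀ = 3∕2`. [cite: MoeglinWaldspurger1995, IV.1.10–IV.1.11, IV.2.3] [cite: Langlands1976, §7] [cite: BernsteinLapid2019, Thm 2.3, §4] -/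
theorem hreal_row_of_truncatedExportsRow (hμu : μω.IsUnitary)
    (hquad : ∀ x : ideleGroup ↥(maximalRealSubfield L), μω (AdeleRing.ideleBaseChange (↥(maximalRealSubfield L)) L x) = quadraticHeckeCharCM L x)
    (hTEXP6 : ∀ (U₀ : Subgroup ↥(finAdelic (↥(maximalRealSubfield L)) L (IsCMField.complexConj L) 3 ((StdForm.antidiagonal 3).over L))) (_ : IsTauLevel L U₀)
      (φ : (quasiSplit (↥(maximalRealSubfield L)) L (IsCMField.complexConj L) 3).Adelic → ℂ) (_ : φ ∈ chiSectionSpacePair (ξ.bcη⁻¹ * ξ.bcψ⁻¹ * μω) ξ.ψ (tauLevel L U₀) ((1 : ↥(tauLevel L U₀) →* ℂ) : ↥(tauLevel L U₀) → ℂ)) (_ : Continuous φ)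
      (_ : IsArchFinite L φ)
      (ν : Measure ↥(adelicUnipotent (↥(maximalRealSubfield L)) L (IsCMField.complexConj L) 3)) (_ : ν.IsHaarMeasure) (𝓕 : Set ↥(adelicUnipotent (↥(maximalRealSubfield L)) L (IsCMField.complexConj L) 3))
      (_ : IsFundamentalDomain ↥(rationalUnipotent (↥(maximalRealSubfield L)) L (IsCMField.complexConj L) 3) 𝓕 ν) (_ : IsCompact (closure 𝓕)) (_ : ν.IsInvInvariant) (_ : ν 𝓕 = 1),
      ∃ (Ec' : ℂ → (quasiSplit (↥(maximalRealSubfield L)) L (IsCMField.complexConj L) 3).Adelic → ℂ) (P : Set ℂ), IsClosed P ∧ (∀ z₀ : ℂ, ∀ᶠ s in 𝓝[≠] z₀, s ∉ P) ∧ (∀ z ∈ P, z.re ≤ 2) ∧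
        (∀ z : ℂ, 2 < z.re → Ec' z = eisensteinSeriesU (flatSectionU φ z)) ∧ (∀ g (z : ℂ), z ∉ P → AnalyticAt ℂ (fun z => Ec' z g) z) ∧
        (∀ z : ℂ, z ∉ P → Continuous (Ec' z)) ∧
        (∀ z₁ : ℂ, z₁ ∉ P → ∀ K : Set (quasiSplit (↥(maximalRealSubfield L)) L (IsCMField.complexConj L) 3).Adelic, IsCompact K → ∃ V ∈ 𝓝 z₁, ∃ M : ℝ, ∀ z ∈ V, ∀ g ∈ K, ‖Ec' z g‖ ≤ M) ∧
        (∀ T : ℝ≥0, 1 ≤ T → ∃ Fam : ℂ → Lp ℂ 2 μ, DifferentiableOn ℂ Fam Pᶜ ∧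
          ∀ z : ℂ, z ∉ P → ((Fam z : Lp ℂ 2 μ) : (quasiSplit (↥(maximalRealSubfield L)) L (IsCMField.complexConj L) 3).automorphicQuotient → ℂ) =ᵐ[μ]
            (quasiSplit (↥(maximalRealSubfield L)) L (IsCMField.complexConj L) 3).quotFun (truncation ν 𝓕 T (Ec' z)))) :
    ∀ (U₀ : Subgroup ↥(finAdelic (↥(maximalRealSubfield L)) L (IsCMField.complexConj L) 3 ((StdForm.antidiagonal 3).over L))) (_ : IsTauLevel L U₀)
      (φ : (quasiSplit (↥(maximalRealSubfield L)) L (IsCMField.complexConj L) 3).Adelic → ℂ) (_ : φ ∈ chiSectionSpacePair (ξ.bcη⁻¹ * ξ.bcψ⁻¹ * μω) ξ.ψ (tauLevel L U₀) ((1 : ↥(tauLevel L U₀) →* ℂ) : ↥(tauLevel L U₀) → ℂ)) (_ : Continuous φ)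
      (_ : IsArchFinite L φ)
      (ν : Measure ↥(adelicUnipotent (↥(maximalRealSubfield L)) L (IsCMField.complexConj L) 3)) (_ : ν.IsHaarMeasure) (𝓕 : Set ↥(adelicUnipotent (↥(maximalRealSubfield L)) L (IsCMField.complexConj L) 3))
      (_ : IsFundamentalDomain ↥(rationalUnipotent (↥(maximalRealSubfield L)) L (IsCMField.complexConj L) 3) 𝓕 ν) (_ : IsCompact (closure 𝓕)) (_ : ν.IsInvInvariant) (_ : ν 𝓕 = 1),
      ∀ (ι : Type) [Fintype ι] (φ' : ι → (quasiSplit (↥(maximalRealSubfield L)) L (IsCMField.complexConj L) 3).Adelic → ℂ) (qv qcv : ι → ℂ → ℂ) (Pv : Set ℂ),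
        LinearIndependent ℂ φ' →
        (∀ j, IsChiSectionPair (reflectChar (IsCMField.complexConj L) (ξ.bcη⁻¹ * ξ.bcψ⁻¹ * μω)) ξ.ψ (φ' j)) →
        (∀ j, Continuous (φ' j)) →
        (∀ j, ∃ C : ℝ, ∀ x, ‖φ' j x‖ ≤ C) →
        (∀ z : ℂ, 2 < z.re → (∑ j, qv j z • φ' j) = ((((ν 𝓕).toReal⁻¹ : ℝ)) : ℂ) • (fun g : (quasiSplit (↥(maximalRealSubfield L)) L (IsCMField.complexConj L) 3).Adelic => (∫ v : ↥(adelicUnipotent (↥(maximalRealSubfield L)) L (IsCMField.complexConj L) 3), flatSectionU φ z ((quasiSplit (↥(maximalRealSubfield L)) L (IsCMField.complexConj L) 3).toAdelic (weylLongU ((IsCMField.complexConj L : L ≃ₐ[↥(maximalRealSubfield L)] L) : L →+* L) (rfl : (StdForm.antidiagonal 3).over L = (StdForm.antidiagonal 3).over L)) * ((v : (quasiSplit (↥(maximalRealSubfield L)) L (IsCMField.complexConj L) 3).Adelic) * g)) ∂ν) * (((borelHeight g : ℝ) : ℂ) ^ (z - 2)))) →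
        (∀ z₀ : ℂ, ∀ᶠ s in 𝓝[≠] z₀, s ∉ Pv) →
        (∀ z ∈ Pv, z.re ≤ 2) →
        (∀ j (z : ℂ), z ∉ Pv → AnalyticAt ℂ (qcv j) z) →
        (∀ j (z : ℂ), 2 < z.re → qcv j z = qv j z) →
      (∀ (μK : Measure ↥((standardMaximalCompactGL 3 L).comap (adelicVal (↥(maximalRealSubfield L)) L (IsCMField.complexConj L) 3 ((StdForm.antidiagonal 3).over L)) : Subgroup (quasiSplit (↥(maximalRealSubfield L)) L (IsCMField.complexConj L) 3).Adelic)) (_ : μK.IsHaarMeasure) (νI : Measure (AdeleRing (𝓞 L) L)ˣ) (_ : νI.IsHaarMeasure) (𝓕I : Set (AdeleRing (𝓞 L) L)ˣ) (_ : IsIdeleClassDomain L 𝓕I) (wc : ℂ → ℂ),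
          (∀ z : ℂ, wc z = (∑ j, qcv j z * ∫ k, φ' j (k : (quasiSplit (↥(maximalRealSubfield L)) L (IsCMField.complexConj L) 3).Adelic) * conj (φ (k : (quasiSplit (↥(maximalRealSubfield L)) L (IsCMField.complexConj L) 3).Adelic)) ∂μK) * ∫ x in {x : (AdeleRing (𝓞 L) L)ˣ | (IdeleClassGroup.ideleNorm L x : ℝ) ≤ 1} ∩ 𝓕I, ((IdeleClassGroup.ideleNorm L x : ℝ) : ℂ) * (((reflectChar (IsCMField.complexConj L) (ξ.bcη⁻¹ * ξ.bcψ⁻¹ * μω) x : ℂˣ) : ℂ) * conj (((ξ.bcη⁻¹ * ξ.bcψ⁻¹ * μω) x : ℂˣ) : ℂ)) ∂νI) → ∀ᶠ x : ℝ in 𝓝[≠] (3 / 2 : ℝ), (wc (x : ℂ)).im = 0) := by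
  intro U₀ hU₀ φ hφV hφc hφa ν hν 𝓕 h𝓕N h𝓕c hνi hν1 ι _ φ' qv qcv Pv _hli _hb hφ'c hφ'bd hqφ hPvcd _hPvre hqcvP hqcvq μK hμK νI hνI 𝓕I h𝓕I wc hwc
  -- the block character: unitary, trivial on the positive real ideles; `ξ.ψ` unitary and automorphic; `φ` a bounded pair-section
  have hχ₁u : ((ξ.bcη⁻¹ * ξ.bcψ⁻¹ * μω)).IsUnitary := isUnitary_blockChar L ξ μω hμu (norm_eta_apply_eq_one L ξ) (norm_psi_apply_eq_one L ξ)
  have hρ₁ : ∀ r : ℝ≥0ˣ, ((ξ.bcη⁻¹ * ξ.bcψ⁻¹ * μω)) (posRealIdele L r) = 1 := midBlockChar_posRealIdele L ξ μω hquad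
  have hφ : IsChiSectionPair (ξ.bcη⁻¹ * ξ.bcψ⁻¹ * μω) ξ.ψ φ := isChiSectionPair_of_mem hφV
  obtain ⟨Cφ, hφC⟩ := exists_norm_le_of_isChiSectionPair L hχ₁u (norm_psi_apply_eq_one L ξ) hφ hφc
  choose Cb hCb using hφ'bd
  -- (E6) at `T = 1` from the exports-with-(E6) τ-row
  obtain ⟨Ec, P₆, hP₆c, hP₆cd, -, hE2, -, -, -, hE6⟩ := hTEXP6 U₀ hU₀ φ hφV hφc hφa ν hν 𝓕 h𝓕N h𝓕c hνi hν1
  obtain ⟨Fam, hFd, hFam⟩ := hE6 1 le_rfl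
  -- (L2) the continued scalars read off the column data (`Pv` is closed: co-discrete)
  have hPvc : IsClosed Pv := isClosed_of_codiscrete hPvcd
  obtain ⟨wc', Bc, hwc', hwagree, hBc1, hBc2, hBagree, hwcf, hBcf⟩ := exists_scalars_of_coords_global L μK νI 𝓕I ν hν1 (ξ.bcη⁻¹ * ξ.bcψ⁻¹ * μω) φ φ' hqφ
    (fun j => differentiableOn_compl_of_analyticAt_off (hqcvP j)) hqcvq hPvc
    (fun j => integrable_restrict_mul_conj_of_bounded L μK (hφ'c j) hφc (hCb j) hφC)
    (fun j l => integrable_restrict_mul_conj_of_bounded L μK (hφ'c j) (hφ'c l) (hCb j) (hCb l))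
  have hww : wc = wc' := funext fun z => by rw [hwc z, hwcf z]
  -- the joint pole set `P₆ ∪ Pv`: closed, co-discrete
  have hPc : IsClosed (P₆ ∪ Pv) := hP₆c.union hPvc
  have hPcd : ∀ z₀ : ℂ, ∀ᶠ s in 𝓝[≠] z₀, s ∉ P₆ ∪ Pv := fun z₀ => ((hP₆cd z₀).and (hPvcd z₀)).mono fun s hs h => h.elim hs.1 hs.2
  have h6 : (P₆ ∪ Pv)ᶜ ⊆ P₆ᶜ := compl_subset_compl.2 subset_union_left
  have hv : (P₆ ∪ Pv)ᶜ ⊆ Pvᶜ := compl_subset_compl.2 subset_union_right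
  -- pointwise reality at every real `x > 1` off `P₆ ∪ Pv` (★ p864973 §2)
  have hpt : ∀ x : ℝ, 1 < x → ((x : ℝ) : ℂ) ∉ P₆ ∪ Pv → (wc (x : ℂ)).im = 0 := by
    intro x hx hxP
    have hxPv : ((x : ℝ) : ℂ) ∉ Pv := fun h => hxP (Or.inr h)
    have hqa₀ : ∀ j, AnalyticAt ℂ (qcv j) ((x : ℝ) : ℂ) := fun j => hqcvP j _ hxPv
    have hβB : ∃ B : ℝ, ∀ᶠ z in 𝓝[≠] ((x : ℝ) : ℂ), ‖Bc z z‖ ≤ B := exists_eventually_norm_kernelDiag_le_of_coords hqa₀ _ _ hBcf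
    rw [hww]
    exact im_wc_eq_zero_of_exports_free L μ νG μK νI h𝓕I ν h𝓕N hν1 h𝓕c hβ (le_refl (1 : ℝ≥0)) hχ₁u hρ₁ (norm_psi_apply_eq_one L ξ) ξ.hψ hφc hφ hφC Ec hE2 hPc hPcd
      Fam (hFd.mono h6) (fun z hz => hFam z fun h => hz (Or.inl h)) (hwc'.mono hv) hwagree (fun z' => (hBc1 z').mono hv)
      (fun z => (hBc2 z).mono fun u hu h => hu (Or.inr h)) hBagree hx hxP hβB
  exact eventually_im_eq_zero_of_real_offPoles hPcd hpt (by norm_num : (1 : ℝ) < 3 / 2)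

include μ hβ hμZ μa μf in
/-- **§2.2 — `hreal_row_of_ports`**: the same row with (E6) DISCHARGED by ★ p865131 `hTEXP6_row_of_ports` — visible: the frame (F)(F′), `hμu`, `hquad`, and the restricted co-weight line `hCO′`
(★-able by J-S8-CO (5)). [cite: MoeglinWaldspurger1995, IV.1.10–IV.1.11] [cite: BernsteinLapid2019, Thm 2.3, §4] [cite: Rogawski1990, §13.9 p. 229 (ii)] -/
theorem hreal_row_of_ports (hμu : μω.IsUnitary)
    (hquad : ∀ x : ideleGroup ↥(maximalRealSubfield L), μω (AdeleRing.ideleBaseChange (↥(maximalRealSubfield L)) L x) = quadraticHeckeCharCM L x)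
    (hCO : ∀ (W₀ : Submodule ℂ ((quasiSplit (↥(maximalRealSubfield L)) L (IsCMField.complexConj L) 3).Adelic → ℂ)) (hW₀K : ∀ k : ↥(archMaximalCompact L), ∀ ψ ∈ W₀, ((rightTranslation (quasiSplit (↥(maximalRealSubfield L)) L (IsCMField.complexConj L) 3)).comp (archMaximalCompact L).subtype) k ψ ∈ W₀) (_ : FiniteDimensional ℂ ↥W₀)
      (_ : ∀ ψ ∈ W₀, IsChiSectionPair (ξ.bcη⁻¹ * ξ.bcψ⁻¹ * μω) ξ.ψ ψ) (_ : ∀ ψ ∈ W₀, Continuous ψ) (_ : (Subrepresentation.toRepresentation (⟨W₀, hW₀K⟩ : Subrepresentation ((rightTranslation (quasiSplit (↥(maximalRealSubfield L)) L (IsCMField.complexConj L) 3)).comp (archMaximalCompact L).subtype))).IsIrreducible),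
      ∃ l₀ : ↥W₀ →ₗ[ℂ] ℂ, ∀ l : ↥W₀ →ₗ[ℂ] ℂ,
        (∀ (m : ↥(arch (↥(maximalRealSubfield L)) L (IsCMField.complexConj L) 3 ((StdForm.antidiagonal 3).over L))) (hmB : (archToAdelic (↥(maximalRealSubfield L)) L (IsCMField.complexConj L) 3 ((StdForm.antidiagonal 3).over L)) m ∈ borelAdelic (↥(maximalRealSubfield L)) L (IsCMField.complexConj L) 3) (hmK : (adelicVal (↥(maximalRealSubfield L)) L (IsCMField.complexConj L) 3 ((StdForm.antidiagonal 3).over L)) ((archToAdelic (↥(maximalRealSubfield L)) L (IsCMField.complexConj L) 3 ((StdForm.antidiagonal 3).over L)) m) ∈ standardMaximalCompactGL 3 L) (w : ↥W₀),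
          l ((Subrepresentation.toRepresentation (⟨W₀, hW₀K⟩ : Subrepresentation ((rightTranslation (quasiSplit (↥(maximalRealSubfield L)) L (IsCMField.complexConj L) 3)).comp (archMaximalCompact L).subtype))) ⟨(archToAdelic (↥(maximalRealSubfield L)) L (IsCMField.complexConj L) 3 ((StdForm.antidiagonal 3).over L)) m, archToAdelic_mem_archMaximalCompact L m hmK⟩ w) = ((((ξ.bcη⁻¹ * ξ.bcψ⁻¹ * μω)) (firstEntryUnit hmB) : ℂˣ) : ℂ) * (((ξ.ψ) (middleEntryUnitary hmB) : ℂˣ) : ℂ) * l w) →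
        ∃ a : ℂ, l = a • l₀) :
    ∀ (U₀ : Subgroup ↥(finAdelic (↥(maximalRealSubfield L)) L (IsCMField.complexConj L) 3 ((StdForm.antidiagonal 3).over L))) (_ : IsTauLevel L U₀)
      (φ : (quasiSplit (↥(maximalRealSubfield L)) L (IsCMField.complexConj L) 3).Adelic → ℂ) (_ : φ ∈ chiSectionSpacePair (ξ.bcη⁻¹ * ξ.bcψ⁻¹ * μω) ξ.ψ (tauLevel L U₀) ((1 : ↥(tauLevel L U₀) →* ℂ) : ↥(tauLevel L U₀) → ℂ)) (_ : Continuous φ)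
      (_ : IsArchFinite L φ)
      (ν : Measure ↥(adelicUnipotent (↥(maximalRealSubfield L)) L (IsCMField.complexConj L) 3)) (_ : ν.IsHaarMeasure) (𝓕 : Set ↥(adelicUnipotent (↥(maximalRealSubfield L)) L (IsCMField.complexConj L) 3))
      (_ : IsFundamentalDomain ↥(rationalUnipotent (↥(maximalRealSubfield L)) L (IsCMField.complexConj L) 3) 𝓕 ν) (_ : IsCompact (closure 𝓕)) (_ : ν.IsInvInvariant) (_ : ν 𝓕 = 1),
      ∀ (ι : Type) [Fintype ι] (φ' : ι → (quasiSplit (↥(maximalRealSubfield L)) L (IsCMField.complexConj L) 3).Adelic → ℂ) (qv qcv : ι → ℂ → ℂ) (Pv : Set ℂ),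
        LinearIndependent ℂ φ' →
        (∀ j, IsChiSectionPair (reflectChar (IsCMField.complexConj L) (ξ.bcη⁻¹ * ξ.bcψ⁻¹ * μω)) ξ.ψ (φ' j)) →
        (∀ j, Continuous (φ' j)) →
        (∀ j, ∃ C : ℝ, ∀ x, ‖φ' j x‖ ≤ C) →
        (∀ z : ℂ, 2 < z.re → (∑ j, qv j z • φ' j) = ((((ν 𝓕).toReal⁻¹ : ℝ)) : ℂ) • (fun g : (quasiSplit (↥(maximalRealSubfield L)) L (IsCMField.complexConj L) 3).Adelic => (∫ v : ↥(adelicUnipotent (↥(maximalRealSubfield L)) L (IsCMField.complexConj L) 3), flatSectionU φ z ((quasiSplit (↥(maximalRealSubfield L)) L (IsCMField.complexConj L) 3).toAdelic (weylLongU ((IsCMField.complexConj L : L ≃ₐ[↥(maximalRealSubfield L)] L) : L →+* L) (rfl : (StdForm.antidiagonal 3).over L = (StdForm.antidiagonal 3).over L)) * ((v : (quasiSplit (↥(maximalRealSubfield L)) L (IsCMField.complexConj L) 3).Adelic) * g)) ∂ν) * (((borelHeight g : ℝ) : ℂ) ^ (z - 2)))) →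
        (∀ z₀ : ℂ, ∀ᶠ s in 𝓝[≠] z₀, s ∉ Pv) →
        (∀ z ∈ Pv, z.re ≤ 2) →
        (∀ j (z : ℂ), z ∉ Pv → AnalyticAt ℂ (qcv j) z) →
        (∀ j (z : ℂ), 2 < z.re → qcv j z = qv j z) →
      (∀ (μK : Measure ↥((standardMaximalCompactGL 3 L).comap (adelicVal (↥(maximalRealSubfield L)) L (IsCMField.complexConj L) 3 ((StdForm.antidiagonal 3).over L)) : Subgroup (quasiSplit (↥(maximalRealSubfield L)) L (IsCMField.complexConj L) 3).Adelic)) (_ : μK.IsHaarMeasure) (νI : Measure (AdeleRing (𝓞 L) L)ˣ) (_ : νI.IsHaarMeasure) (𝓕I : Set (AdeleRing (𝓞 L) L)ˣ) (_ : IsIdeleClassDomain L 𝓕I) (wc : ℂ → ℂ),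
          (∀ z : ℂ, wc z = (∑ j, qcv j z * ∫ k, φ' j (k : (quasiSplit (↥(maximalRealSubfield L)) L (IsCMField.complexConj L) 3).Adelic) * conj (φ (k : (quasiSplit (↥(maximalRealSubfield L)) L (IsCMField.complexConj L) 3).Adelic)) ∂μK) * ∫ x in {x : (AdeleRing (𝓞 L) L)ˣ | (IdeleClassGroup.ideleNorm L x : ℝ) ≤ 1} ∩ 𝓕I, ((IdeleClassGroup.ideleNorm L x : ℝ) : ℂ) * (((reflectChar (IsCMField.complexConj L) (ξ.bcη⁻¹ * ξ.bcψ⁻¹ * μω) x : ℂˣ) : ℂ) * conj (((ξ.bcη⁻¹ * ξ.bcψ⁻¹ * μω) x : ℂˣ) : ℂ)) ∂νI) → ∀ᶠ x : ℝ in 𝓝[≠] (3 / 2 : ℝ), (wc (x : ℂ)).im = 0) :=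
  hreal_row_of_truncatedExportsRow L μ νG hβ ξ μω hμu hquad (hTEXP6_row_of_ports L μ νG hβ hμZ μa μf ξ μω hμu hCO)

/-! ## §3 `hPreal` reduced to off-axis boundedness [MW95 IV.1.11] (with the exports' normal-form clause) -/

/-- **NORMAL FORM + BOUNDED NEAR `z₀` ⇒ ANALYTIC AT `z₀`**, coordinatewise: if every `qcv j` is in meromorphic normal form and the tuple is bounded on a punctured neighbourhood of `z₀`, each
`qcv j` is analytic at `z₀` (★ `MeromorphicNFAt.analyticAt_of_eventually_norm_le`). [cite: Conway1978, V §1] [cite: MoeglinWaldspurger1995, IV.1.9] -/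
theorem analyticAt_offAxis_of_bound {ι : Type*} {qcv : ι → ℂ → ℂ} (hNF : ∀ j, MeromorphicNFOn (qcv j) univ) {z₀ : ℂ}
    (hbd : ∃ C : ℝ, ∀ᶠ z in 𝓝[≠] z₀, ∀ j, ‖qcv j z‖ ≤ C) (j : ι) : AnalyticAt ℂ (qcv j) z₀ := by
  obtain ⟨C, hC⟩ := hbd
  exact (hNF j (mem_univ z₀)).analyticAt_of_eventually_norm_le ⟨C, hC.mono fun z hz => hz j⟩

omit [BorelSpace (quasiSplit (↥(maximalRealSubfield L)) L (IsCMField.complexConj L) 3).Adelic] [MeasurableSpace ↥(arch (↥(maximalRealSubfield L)) L (IsCMField.complexConj L) 3 ((StdForm.antidiagonal 3).over L))] [BorelSpace ↥(arch (↥(maximalRealSubfield L)) L (IsCMField.complexConj L) 3 ((StdForm.antidiagonal 3).over L))] [MeasurableSpace ↥(finAdelic (↥(maximalRealSubfield L)) L (IsCMField.complexConj L) 3 ((StdForm.antidiagonal 3).over L))] [BorelSpace ↥(finAdelic (↥(maximalRealSubfield L)) L (IsCMField.complexConj L) 3 ((StdForm.antidiagonal 3).over L))]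
  [MeasurableSpace (AdeleRing (𝓞 L) L)ˣ] [BorelSpace (AdeleRing (𝓞 L) L)ˣ] [(quasiSplit (↥(maximalRealSubfield L)) L (IsCMField.complexConj L) 3).IsAutomorphicMeasure μ] in
/-- **§3 — `hPreal_row_of_offAxisBound`**: V2's per-generator OFF-AXIS POLE-EXCLUSION letter `hPreal` (★ p865056 :217–:232) — for the column data WITH the exports' normal-form clause
`∀ j, MeromorphicNFOn (qcv j) univ` appended (flag to V3: without it the ∀-letter is not dischargeable) — from the honest [MW95 IV.1.11] letter **`hOFFBD`**: near every off-axis point of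
`{1 < Re}` the continued coordinates are BOUNDED (the positivity argument on the Maass–Selberg diagonal identity; not proved here).  Conclusion: `∀ j z, 1 < z.re → z.im ≠ 0 → AnalyticAt ℂ (qcv j) z`.
[cite: MoeglinWaldspurger1995, IV.1.11, IV.2.3] [cite: Langlands1976, §7] [cite: Conway1978, V §1] -/
theorem hPreal_row_of_offAxisBound
    (hOFFBD : ∀ (U₀ : Subgroup ↥(finAdelic (↥(maximalRealSubfield L)) L (IsCMField.complexConj L) 3 ((StdForm.antidiagonal 3).over L))) (_ : IsTauLevel L U₀)
      (φ : (quasiSplit (↥(maximalRealSubfield L)) L (IsCMField.complexConj L) 3).Adelic → ℂ) (_ : φ ∈ chiSectionSpacePair (ξ.bcη⁻¹ * ξ.bcψ⁻¹ * μω) ξ.ψ (tauLevel L U₀) ((1 : ↥(tauLevel L U₀) →* ℂ) : ↥(tauLevel L U₀) → ℂ)) (_ : Continuous φ)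
      (_ : IsArchFinite L φ)
      (ν : Measure ↥(adelicUnipotent (↥(maximalRealSubfield L)) L (IsCMField.complexConj L) 3)) (_ : ν.IsHaarMeasure) (𝓕 : Set ↥(adelicUnipotent (↥(maximalRealSubfield L)) L (IsCMField.complexConj L) 3))
      (_ : IsFundamentalDomain ↥(rationalUnipotent (↥(maximalRealSubfield L)) L (IsCMField.complexConj L) 3) 𝓕 ν) (_ : IsCompact (closure 𝓕)) (_ : ν.IsInvInvariant) (_ : ν 𝓕 = 1),
      ∀ (ι : Type) [Fintype ι] (φ' : ι → (quasiSplit (↥(maximalRealSubfield L)) L (IsCMField.complexConj L) 3).Adelic → ℂ) (qv qcv : ι → ℂ → ℂ) (Pv : Set ℂ),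
        LinearIndependent ℂ φ' →
        (∀ j, IsChiSectionPair (reflectChar (IsCMField.complexConj L) (ξ.bcη⁻¹ * ξ.bcψ⁻¹ * μω)) ξ.ψ (φ' j)) →
        (∀ j, Continuous (φ' j)) →
        (∀ j, ∃ C : ℝ, ∀ x, ‖φ' j x‖ ≤ C) →
        (∀ z : ℂ, 2 < z.re → (∑ j, qv j z • φ' j) = ((((ν 𝓕).toReal⁻¹ : ℝ)) : ℂ) • (fun g : (quasiSplit (↥(maximalRealSubfield L)) L (IsCMField.complexConj L) 3).Adelic => (∫ v : ↥(adelicUnipotent (↥(maximalRealSubfield L)) L (IsCMField.complexConj L) 3), flatSectionU φ z ((quasiSplit (↥(maximalRealSubfield L)) L (IsCMField.complexConj L) 3).toAdelic (weylLongU ((IsCMField.complexConj L : L ≃ₐ[↥(maximalRealSubfield L)] L) : L →+* L) (rfl : (StdForm.antidiagonal 3).over L = (StdForm.antidiagonal 3).over L)) * ((v : (quasiSplit (↥(maximalRealSubfield L)) L (IsCMField.complexConj L) 3).Adelic) * g)) ∂ν) * (((borelHeight g : ℝ) : ℂ) ^ (z - 2)))) →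
        (∀ z₀ : ℂ, ∀ᶠ s in 𝓝[≠] z₀, s ∉ Pv) →
        (∀ z ∈ Pv, z.re ≤ 2) →
        (∀ j (z : ℂ), z ∉ Pv → AnalyticAt ℂ (qcv j) z) →
        (∀ j (z : ℂ), 2 < z.re → qcv j z = qv j z) →
        (∀ j, MeromorphicNFOn (qcv j) univ) →
      ∀ z₀ : ℂ, 1 < z₀.re → z₀.im ≠ 0 → ∃ C : ℝ, ∀ᶠ z in 𝓝[≠] z₀, ∀ j, ‖qcv j z‖ ≤ C) :
    ∀ (U₀ : Subgroup ↥(finAdelic (↥(maximalRealSubfield L)) L (IsCMField.complexConj L) 3 ((StdForm.antidiagonal 3).over L))) (_ : IsTauLevel L U₀)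
      (φ : (quasiSplit (↥(maximalRealSubfield L)) L (IsCMField.complexConj L) 3).Adelic → ℂ) (_ : φ ∈ chiSectionSpacePair (ξ.bcη⁻¹ * ξ.bcψ⁻¹ * μω) ξ.ψ (tauLevel L U₀) ((1 : ↥(tauLevel L U₀) →* ℂ) : ↥(tauLevel L U₀) → ℂ)) (_ : Continuous φ)
      (_ : IsArchFinite L φ)
      (ν : Measure ↥(adelicUnipotent (↥(maximalRealSubfield L)) L (IsCMField.complexConj L) 3)) (_ : ν.IsHaarMeasure) (𝓕 : Set ↥(adelicUnipotent (↥(maximalRealSubfield L)) L (IsCMField.complexConj L) 3))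
      (_ : IsFundamentalDomain ↥(rationalUnipotent (↥(maximalRealSubfield L)) L (IsCMField.complexConj L) 3) 𝓕 ν) (_ : IsCompact (closure 𝓕)) (_ : ν.IsInvInvariant) (_ : ν 𝓕 = 1),
      ∀ (ι : Type) [Fintype ι] (φ' : ι → (quasiSplit (↥(maximalRealSubfield L)) L (IsCMField.complexConj L) 3).Adelic → ℂ) (qv qcv : ι → ℂ → ℂ) (Pv : Set ℂ),
        LinearIndependent ℂ φ' →
        (∀ j, IsChiSectionPair (reflectChar (IsCMField.complexConj L) (ξ.bcη⁻¹ * ξ.bcψ⁻¹ * μω)) ξ.ψ (φ' j)) →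
        (∀ j, Continuous (φ' j)) →
        (∀ j, ∃ C : ℝ, ∀ x, ‖φ' j x‖ ≤ C) →
        (∀ z : ℂ, 2 < z.re → (∑ j, qv j z • φ' j) = ((((ν 𝓕).toReal⁻¹ : ℝ)) : ℂ) • (fun g : (quasiSplit (↥(maximalRealSubfield L)) L (IsCMField.complexConj L) 3).Adelic => (∫ v : ↥(adelicUnipotent (↥(maximalRealSubfield L)) L (IsCMField.complexConj L) 3), flatSectionU φ z ((quasiSplit (↥(maximalRealSubfield L)) L (IsCMField.complexConj L) 3).toAdelic (weylLongU ((IsCMField.complexConj L : L ≃ₐ[↥(maximalRealSubfield L)] L) : L →+* L) (rfl : (StdForm.antidiagonal 3).over L = (StdForm.antidiagonal 3).over L)) * ((v : (quasiSplit (↥(maximalRealSubfield L)) L (IsCMField.complexConj L) 3).Adelic) * g)) ∂ν) * (((borelHeight g : ℝ) : ℂ) ^ (z - 2)))) →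
        (∀ z₀ : ℂ, ∀ᶠ s in 𝓝[≠] z₀, s ∉ Pv) →
        (∀ z ∈ Pv, z.re ≤ 2) →
        (∀ j (z : ℂ), z ∉ Pv → AnalyticAt ℂ (qcv j) z) →
        (∀ j (z : ℂ), 2 < z.re → qcv j z = qv j z) →
        (∀ j, MeromorphicNFOn (qcv j) univ) →
      ∀ j (z : ℂ), 1 < z.re → z.im ≠ 0 → AnalyticAt ℂ (qcv j) z := by
  intro U₀ hU₀ φ hφV hφc hφa ν hν 𝓕 h𝓕N h𝓕c hνi hν1 ι _ φ' qv qcv Pv hli hb hφ'c hφ'bd hqφ hPvcd hPvre hqcvP hqcvq hNF j z hz hzim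
  exact analyticAt_offAxis_of_bound hNF (hOFFBD U₀ hU₀ φ hφV hφc hφa ν hν 𝓕 h𝓕N h𝓕c hνi hν1 ι φ' qv qcv Pv hli hb hφ'c hφ'bd hqφ hPvcd hPvre hqcvP hqcvq hNF z hz hzim) j

end Row

end Summit.HodgeConjecture.HodgeConjecture.R90.S8

end
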